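import Summits.QuantumFields.BalabanUV.Beta.D1BFx.PackedColumnEnvelope
import Literature.MathematicalPhysics.QuantumFieldTheory.Balaban1983to89.Beta.AveragingWardStencils

/-!
# `BalabanUV.Beta.D1BFx.DressedVertexSplit` — road «BF-x» for binder row D1, slot (K), PART 24 letter **L-h♭, PART C (THE VERTEX LEVEL): «THE DRESSED FIRST-ORDER
# VERTEX IS THE SMOOTH-COLUMN VERTEX MINUS THE GAUGE FUNCTION AGAINST THE STENCIL's FINE DIVERGENCE»** — for ANY packed kernel `K`, in-block root, ANY local stencil `S`:
# `vertexOfK (coDressKBmAt (toSite r) N K) N S μ y = vertexOfK K N S μ y − wsum χ_{r;μ,y} (divV S)`, `χ_{r;μ,y} := bmGaugeAt (toSite r) (colH K N μ y) N`,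
# `divV S u = Σ_κ (S κ (u − e_κ) − S κ u)` (an2's `KernelWard.divV` read in the STENCIL's fine slot) — the column split `colH (coDressKBmAt …) = colH K − dχ`
# (`GAN24/CoDressedColumnPairing.colH_coDressKBmAt_eq_sub_grad`) followed by ONE summation by parts on the fine lattice, `Σ_κ Σ'_u (χ(u + e_κ) − χ u)·S κ u = Σ'_u χ u·(divV S u)`,
# all series absolutely convergent (block envelope of the column ⇒ `ℓ¹` decay of `χ`; `LocStencil S`)

HONEST DEPENDENCY (cell records, verbatim): «continuum YM on T⁴ ⇐ BetaPertH ∧ nine spine estimates (0/9 proved); BetaPertH ⇐ (D1) ∧ (D4) ∧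
CAP+tail; G-an2-4 gates asym, D1 and NE2/3/4.»  HONEST FRAMING (cell contract, verbatim): «discharging `BetaPertH` makes Bałaban's UV stability
UNCONDITIONAL — a real constructive-QFT result; it is NOT the continuum limit and NOT the Clay problem.»  THIS MODULE is [folklore] `tsum` bookkeeping BY NAME over an2's
`OneStepKernelFamily.vertexOfK ∕ colH`, `OneStepResolventKernel.wsum ∕ summable_wsumTerm ∕ LocStencil ∕ biLoc_mono`, `KernelWard.divV`, gan24's `CoDressedColumnPairing.
colH_coDressKBmAt_eq_sub_grad` ∕ `DressedLegEnvelope.abs_bmGaugeAt_le_of_blockwise` ∕ `EnvelopeBlockSum.env_le_exp_l1 ∕ env_wobble`, g53's `PackedColumnEnvelope.l1_unitVec_eq_one`;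
`K`, `S` ARBITRARY (displayed block envelope ∕ `LocStencil`); no `def`, no `def … : Prop`, nothing cited, NO printed hypothesis, 0 sorry.  WHAT IT IS: the «(L-h♭)» input line of the
OWNER d1-p2 g23's `COLUMN-GAUGE-INSTANCE-SPEC-g23.md` 4945d4a0ecaae7b1 (journal l.49890: «`V^{bm} μ y = V^{smooth} μ y + G μ y`, `G μ y := −Σ_{κ,u} (dχ_{r;μ,y})(κ,u) • S⁰ κ u =
Σ_u χ_{r;μ,y}(u) • divV S⁰ u` — sign∕orientation to be fixed against `KernelWard.divV`'s convention; the series is absolutely convergent») made a kernel identity WITH THE SIGN FIXED: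
`G μ y = − wsum χ_{r;μ,y} (divV S⁰)`.  WHAT IT IS NOT: NOT the slot Ward letters (`divV S⁰ u = [𝕄₀, D_u]` at the literal's pins — an1∕an3∕the OWNER's FILE 1); NOT a (1.22) row;
0 root-level binders of row D1 discharged (hW ∕ hR-sockets ∕ hSX-socket ∕ D1Tel ∕ D1Rep = 0); (K) NOT closed; NOT D1, NOT `BetaPertH`, NOT continuum, NOT Clay.

ABSOLUTE RULE (cell charter, verbatim): «No internally-minted statement may enter as a cited fact. Every hypothesis is either kernel-proved in
this package or a verbatim quotation of a PUBLISHED theorem with page reference. The manuscript(s) under audit are NOT citable for their own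
disputed steps — they are the thing under adjudication; programme-internal (2001/route/tribunal) claims are never citable.»

CONTENT (dimension `d + 1`).
* §1 [folklore] `abs_weight_le_of_blockEnvelope` (a block envelope `M·e^{−c‖⌊u∕N⌋ − y‖∞}` is an `ℓ¹` decay `M·e^{c}·e^{−(c∕((d+1)N))|u − N•y|₁}`), `abs_bmGaugeAt_weight_le` (the gauge function
  `χ` of such a column: `2(d+1)N·M·e^{c}·e^{−(c∕((d+1)N))|u − N•y|₁}`), `abs_grad_weight_le` (its unit differences: one more factor `(1 + e^{c})`).
* §2 [folklore] **`sum_wsum_grad_eq_wsum_divV`** — THE FINE SUMMATION BY PARTS: for a weight `χ` with `ℓ¹` decay from `p` and a `LocStencil S`,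
  `(fun x z a b ↦ Σ_κ wsum (grad χ κ) (S κ) x z a b) = wsum χ (divV S)`.
* §3 [folklore] **`vertexOfK_coDressKBmAt_eq_sub`** — THE DRESSED VERTEX SPLIT of the title (block envelope on `colH K N μ y`, `LocStencil S Cs δs`, `0 < δs`, in-block root).
Unit `b2b-balaban-beta-d1-formalise-leaf-01` (gen 29), D1 formalisation swarm LEAF PROVER 01, road «BF-x»; COMMISSION C-g23-1 (L-h♭) ∕ S-g23-2 input (L-h♭); INTENT «L-h♭ PART C»
(journal).  Not in print; our bookkeeping.  No existing file touched.
-/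

noncomputable section

namespace Summit.QuantumFields.BalabanUV.Beta.D1BFx.DressedVertexSplit

open Finset
open scoped BigOperators
open Literature.MathematicalPhysics.QuantumFieldTheory
open Literature.MathematicalPhysics.QuantumFieldTheory.LatticeForm (quo)
open Literature.MathematicalPhysics.QuantumFieldTheory.Balaban1983to89
open Literature.MathematicalPhysics.QuantumFieldTheory.Balaban1983to89.Beta
open B12Sec2to5 (l1 l1_nonneg)
open B4ContourShift (supNorm)
open ExpKernelCalculus (MKer BiLoc summable_exp_shift l1_sub_triangle)
open AffineAveraging (Form0 Form1 Site box toSite unitVec)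
open AveragingContours (grad)
open OneStepResolventKernel (Fib wsum LocStencil summable_wsumTerm biLoc_mono)
open OneStepKernelFamily (colH vertexOfK)
open KernelWard (divV)
open Summit.QuantumFields.BalabanUV.Beta.AxialDressingRooted (coDressKBmAt)
open Summit.QuantumFields.BalabanUV.Beta.AxialProjectorBlockMean (bmGaugeAt)
open Summit.QuantumFields.BalabanUV.Beta.GAN24.CoDressedColumnPairing (colH_coDressKBmAt_eq_sub_grad)
open Summit.QuantumFields.BalabanUV.Beta.GAN24.DressedLegEnvelope (abs_bmGaugeAt_le_of_blockwise)
open Summit.QuantumFields.BalabanUV.Beta.GAN24.EnvelopeBlockSum (env_le_exp_l1 env_wobble)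
open Summit.QuantumFields.BalabanUV.Beta.D1BFx.PackedColumnEnvelope (l1_unitVec_eq_one)
open AveragingWardStencils (b6UnitVec_eq)

variable {d : ℕ}

/-! ## §1 Block envelopes as `ℓ¹` decays; the gauge function and its unit differences as weights -/

/-- [folklore] A BLOCK ENVELOPE IS AN `ℓ¹` DECAY: `|w u| ≤ M·e^{−c‖⌊u∕N⌋ − y‖∞}` (`M, c ≥ 0`, `N ≥ 1`) gives `|w u| ≤ (M·e^{c})·e^{−(c∕((d+1)N))·|u − N•y|₁}` (`env_le_exp_l1`). -/
theorem abs_weight_le_of_blockEnvelope {N : ℕ} (hN : 1 ≤ N) {w : Site (d + 1) → ℝ} {M c : ℝ} (hM : 0 ≤ M) (hc : 0 ≤ c) (y : Site (d + 1))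
    (hw : ∀ u, |w u| ≤ M * Real.exp (-(c * supNorm (quo N u - y)))) (u : Site (d + 1)) :
    |w u| ≤ M * Real.exp c * Real.exp (-(c / (((d : ℝ) + 1) * N)) * l1 (u - (N : ℤ) • y)) := by
  refine (hw u).trans ?_
  rw [mul_assoc]
  exact mul_le_mul_of_nonneg_left (env_le_exp_l1 (d := d) hN hc y u) hM

/-- [folklore] **THE GAUGE FUNCTION OF A BLOCK-ENVELOPED COLUMN IS AN `ℓ¹`-DECAYING WEIGHT**: `|χ u| ≤ (2(d+1)N·M·e^{c})·e^{−(c∕((d+1)N))·|u − N•y|₁}` for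
`χ := bmGaugeAt (toSite r) (colH K N μ y) N` (`abs_bmGaugeAt_le_of_blockwise` + §1's first line). -/
theorem abs_bmGaugeAt_weight_le {N : ℕ} (hN : 1 ≤ N) {r : Fin (d + 1) → ℕ} (hr : r ∈ box (d + 1) N) (K : MKer (d + 1) (Fib d)) (μ : Fin (d + 1))
    (y : Site (d + 1)) {M c : ℝ} (hM : 0 ≤ M) (hc : 0 ≤ c) (hK : ∀ κ u, |colH K N μ y κ u| ≤ M * Real.exp (-(c * supNorm (quo N u - y)))) (u : Site (d + 1)) :
    |bmGaugeAt (toSite r) (colH K N μ y) N u| ≤ (2 * (((d : ℝ) + 1) * N) * M) * Real.exp c * Real.exp (-(c / (((d : ℝ) + 1) * N)) * l1 (u - (N : ℤ) • y)) := by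
  have hχ : ∀ p, |bmGaugeAt (toSite r) (colH K N μ y) N p| ≤ (2 * (((d : ℝ) + 1) * N) * M) * Real.exp (-(c * supNorm (quo N p - y))) := fun p => by
    have h := abs_bmGaugeAt_le_of_blockwise hN hr (A := colH K N μ y) (S := fun b => M * Real.exp (-(c * supNorm (b - y)))) (fun κ z => hK κ z) p
    refine h.trans (le_of_eq ?_)
    rw [show quo N p = AveragingContours.blk N p from rfl]
    ring
  have hN0 : (0 : ℝ) < N := by exact_mod_cast hN
  exact abs_weight_le_of_blockEnvelope hN (by positivity) hc y hχ u

/-- [folklore] **ITS UNIT DIFFERENCES ARE `ℓ¹`-DECAYING WEIGHTS TOO**: `|χ (u + e_κ) − χ u| ≤ (2(d+1)N·M·(1 + e^{c})·e^{c})·e^{−(c∕((d+1)N))·|u − N•y|₁}` (the shifted endpoint's block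
label moves by at most one: `env_wobble`). -/
theorem abs_grad_weight_le {N : ℕ} (hN : 1 ≤ N) {r : Fin (d + 1) → ℕ} (hr : r ∈ box (d + 1) N) (K : MKer (d + 1) (Fib d)) (μ : Fin (d + 1))
    (y : Site (d + 1)) {M c : ℝ} (hM : 0 ≤ M) (hc : 0 ≤ c) (hK : ∀ κ u, |colH K N μ y κ u| ≤ M * Real.exp (-(c * supNorm (quo N u - y)))) (κ : Fin (d + 1))
    (u : Site (d + 1)) :
    |grad (bmGaugeAt (toSite r) (colH K N μ y) N) κ u|
      ≤ (2 * (((d : ℝ) + 1) * N) * M * (1 + Real.exp c)) * Real.exp c * Real.exp (-(c / (((d : ℝ) + 1) * N)) * l1 (u - (N : ℤ) • y)) := by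
  have hχ : ∀ p, |bmGaugeAt (toSite r) (colH K N μ y) N p| ≤ (2 * (((d : ℝ) + 1) * N) * M) * Real.exp (-(c * supNorm (quo N p - y))) := fun p => by
    have h := abs_bmGaugeAt_le_of_blockwise hN hr (A := colH K N μ y) (S := fun b => M * Real.exp (-(c * supNorm (b - y)))) (fun κ z => hK κ z) p
    refine h.trans (le_of_eq ?_)
    rw [show quo N p = AveragingContours.blk N p from rfl]
    ring
  have hN0 : (0 : ℝ) < N := by exact_mod_cast hN
  have hD : 0 ≤ 2 * (((d : ℝ) + 1) * N) * M := by positivity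
  -- the difference has the block envelope with the factor `(1 + e^{c})`
  have hdiff : ∀ p, |grad (bmGaugeAt (toSite r) (colH K N μ y) N) κ p|
      ≤ (2 * (((d : ℝ) + 1) * N) * M * (1 + Real.exp c)) * Real.exp (-(c * supNorm (quo N p - y))) := fun p => by
    have hE : Real.exp (-(c * supNorm (quo N (p + unitVec κ) - y))) ≤ Real.exp c * Real.exp (-(c * supNorm (quo N p - y))) := by
      have h := env_wobble (d := d) hN hc y p (p + unitVec κ)
      rw [add_sub_cancel_left, l1_unitVec_eq_one, mul_one] at h
      exact h
    have h1 : |bmGaugeAt (toSite r) (colH K N μ y) N (p + unitVec κ)| ≤ (2 * (((d : ℝ) + 1) * N) * M) * (Real.exp c * Real.exp (-(c * supNorm (quo N p - y)))) :=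
      (hχ (p + unitVec κ)).trans (mul_le_mul_of_nonneg_left hE hD)
    have h2 := hχ p
    show |bmGaugeAt (toSite r) (colH K N μ y) N (p + unitVec κ) - bmGaugeAt (toSite r) (colH K N μ y) N p| ≤ _
    calc |bmGaugeAt (toSite r) (colH K N μ y) N (p + unitVec κ) - bmGaugeAt (toSite r) (colH K N μ y) N p|
        ≤ |bmGaugeAt (toSite r) (colH K N μ y) N (p + unitVec κ)| + |bmGaugeAt (toSite r) (colH K N μ y) N p| := abs_sub _ _
      _ ≤ (2 * (((d : ℝ) + 1) * N) * M) * (Real.exp c * Real.exp (-(c * supNorm (quo N p - y))))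
          + (2 * (((d : ℝ) + 1) * N) * M) * Real.exp (-(c * supNorm (quo N p - y))) := add_le_add h1 h2
      _ = (2 * (((d : ℝ) + 1) * N) * M * (1 + Real.exp c)) * Real.exp (-(c * supNorm (quo N p - y))) := by ring
  exact abs_weight_le_of_blockEnvelope hN (by positivity) hc y hdiff u

/-! ## §2 The fine summation by parts: `Σ_κ wsum (grad χ κ) (S κ) = wsum χ (divV S)` -/

/-- [folklore] **THE FINE SUMMATION BY PARTS.**  For a weight `χ` with `|χ u| ≤ C·e^{−δ|u − p|₁}` (`C ≥ 0`) and a `LocStencil S Cs δ` (`δ > 0`):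
`(x z a b ↦ Σ_κ wsum (grad χ κ) (S κ) x z a b) = wsum χ (divV S)` — `Σ'_u (χ(u + e_κ) − χ u)·S κ u = Σ'_v χ v·S κ (v − e_κ) − Σ'_u χ u·S κ u` (reindex `v := u + e_κ`; both series
absolutely convergent by `summable_wsumTerm`, the shifted weight decaying from `p − e_κ`), summed over `κ`; `divV S v = Σ_κ (S κ (v − e_κ) − S κ v)` (`KernelWard.divV`). -/
theorem sum_wsum_grad_eq_wsum_divV {χ : Site (d + 1) → ℝ} {S : Fin (d + 1) → Site (d + 1) → MKer (d + 1) (Fib d)} {C Cs δ : ℝ} {p : Site (d + 1)}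
    (hχ : ∀ u, |χ u| ≤ C * Real.exp (-δ * l1 (u - p))) (hS : LocStencil S Cs δ) (hδ : 0 < δ) (hC : 0 ≤ C) :
    (fun x z a b => ∑ κ : Fin (d + 1), wsum (grad χ κ) (S κ) x z a b) = wsum χ (divV S) := by
  funext x z a b
  -- the shifted weight `u ↦ χ (u + e_κ)` decays from `p − e_κ`
  have hχs : ∀ (κ : Fin (d + 1)) (u : Site (d + 1)), |χ (u + unitVec κ)| ≤ C * Real.exp (-δ * l1 (u - (p - unitVec κ))) := fun κ u => by
    have h := hχ (u + unitVec κ)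
    rwa [show u + unitVec κ - p = u - (p - unitVec κ) from by abel] at h
  have hs₁ : ∀ κ : Fin (d + 1), Summable fun u : Site (d + 1) => χ (u + unitVec κ) * S κ u x z a b :=
    fun κ => summable_wsumTerm (hχs κ) (fun u => hS κ u) hδ hC x z a b
  have hs₀ : ∀ κ : Fin (d + 1), Summable fun u : Site (d + 1) => χ u * S κ u x z a b :=
    fun κ => summable_wsumTerm hχ (fun u => hS κ u) hδ hC x z a b
  -- the shifted series, reindexed: `Σ'_u χ (u + e_κ)·S κ u = Σ'_v χ v·S κ (v − e_κ)`
  have hre : ∀ κ : Fin (d + 1), ∑' u : Site (d + 1), χ (u + unitVec κ) * S κ u x z a b = ∑' v : Site (d + 1), χ v * S κ (v - unitVec κ) x z a b := fun κ => by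
    rw [← (Equiv.subRight (unitVec κ)).tsum_eq]
    refine tsum_congr fun v => ?_
    simp only [Equiv.subRight_apply, sub_add_cancel]
  have hs₂ : ∀ κ : Fin (d + 1), Summable fun v : Site (d + 1) => χ v * S κ (v - unitVec κ) x z a b := fun κ => by
    have h := (Equiv.subRight (unitVec κ)).summable_iff.mpr (hs₁ κ)
    refine h.congr fun v => ?_
    simp only [Function.comp, Equiv.subRight_apply, sub_add_cancel]
  -- each `κ`-term
  have hκ : ∀ κ : Fin (d + 1), wsum (grad χ κ) (S κ) x z a b = ∑' v : Site (d + 1), χ v * (S κ (v - unitVec κ) x z a b - S κ v x z a b) := fun κ => by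
    show (∑' u : Site (d + 1), (χ (u + unitVec κ) - χ u) * S κ u x z a b) = _
    have e1 : (fun u : Site (d + 1) => (χ (u + unitVec κ) - χ u) * S κ u x z a b)
        = fun u => χ (u + unitVec κ) * S κ u x z a b - χ u * S κ u x z a b := funext fun u => by ring
    rw [e1, (hs₁ κ).tsum_sub (hs₀ κ), hre κ, ← (hs₂ κ).tsum_sub (hs₀ κ)]
    exact tsum_congr fun v => by ring
  rw [Finset.sum_congr rfl fun κ _ => hκ κ, ← Summable.tsum_finsetSum (fun κ _ => ((hs₂ κ).sub (hs₀ κ)).congr fun v => by ring)]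
  show _ = ∑' v : Site (d + 1), χ v * (divV S v) x z a b
  refine tsum_congr fun v => ?_
  rw [← Finset.mul_sum]
  congr 1
  simp only [KernelWard.divV, Finset.sum_apply, Pi.sub_apply, b6UnitVec_eq]

/-! ## §3 The dressed vertex split -/

/-- [folklore] **THE DRESSED FIRST-ORDER VERTEX IS THE SMOOTH-COLUMN VERTEX MINUS THE GAUGE FUNCTION AGAINST THE STENCIL's FINE DIVERGENCE.**  For ANY packed `K` whose
`ℋ`-column at `(μ, y)` has a block envelope `|colH K N μ y κ u| ≤ M·e^{−c‖⌊u∕N⌋ − y‖∞}` (`M ≥ 0`, `c > 0`), ANY `LocStencil S Cs δs` (`δs > 0`), in-block root `r`, `N ≥ 1`: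
`vertexOfK (coDressKBmAt (toSite r) N K) N S μ y = vertexOfK K N S μ y − wsum (bmGaugeAt (toSite r) (colH K N μ y) N) (divV S)`.
So in the OWNER's notation `V^{bm} = V^{smooth} + G` with **`G μ y = − wsum χ_{r;μ,y} (divV S)`** (sign fixed against `KernelWard.divV`). -/
theorem vertexOfK_coDressKBmAt_eq_sub {N : ℕ} (hN : 1 ≤ N) {r : Fin (d + 1) → ℕ} (hr : r ∈ box (d + 1) N) (K : MKer (d + 1) (Fib d))
    {S : Fin (d + 1) → Site (d + 1) → MKer (d + 1) (Fib d)} {Cs δs : ℝ} (hS : LocStencil S Cs δs) (hδs : 0 < δs)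
    (μ : Fin (d + 1)) (y : Site (d + 1)) {M c : ℝ} (hM : 0 ≤ M) (hc : 0 < c)
    (hK : ∀ κ u, |colH K N μ y κ u| ≤ M * Real.exp (-(c * supNorm (quo N u - y)))) :
    vertexOfK (coDressKBmAt (toSite r) N K) N S μ y
      = vertexOfK K N S μ y - wsum (bmGaugeAt (toSite r) (colH K N μ y) N) (divV S) := by
  -- one common `ℓ¹` rate for the three weights (column, gauge function, its gradient) and the stencil
  have hN0 : (0 : ℝ) < N := by exact_mod_cast hN
  set δ₀ : ℝ := min (c / (((d : ℝ) + 1) * N)) δs with hδ₀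
  have hδ₀pos : 0 < δ₀ := lt_min (by positivity) hδs
  have hδ₀c : δ₀ ≤ c / (((d : ℝ) + 1) * N) := min_le_left _ _
  have hδ₀s : δ₀ ≤ δs := min_le_right _ _
  have hCs : 0 ≤ Cs := ((hS 0 0).nonneg (Sum.inl 0))
  have hS₀ : LocStencil S Cs δ₀ := fun κ u => biLoc_mono (hS κ u) hCs hδ₀s
  have hrelax : ∀ {w : Site (d + 1) → ℝ} {A : ℝ}, (∀ u, |w u| ≤ A * Real.exp (-(c / (((d : ℝ) + 1) * N)) * l1 (u - (N : ℤ) • y))) → 0 ≤ A →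
      ∀ u, |w u| ≤ A * Real.exp (-δ₀ * l1 (u - (N : ℤ) • y)) := fun hw hA u =>
    (hw u).trans (mul_le_mul_of_nonneg_left (Real.exp_le_exp.2 (by nlinarith [l1_nonneg (u - (N : ℤ) • y)])) hA)
  -- the weights
  have hcol : ∀ κ u, |colH K N μ y κ u| ≤ M * Real.exp c * Real.exp (-δ₀ * l1 (u - (N : ℤ) • y)) := fun κ =>
    hrelax (fun u => abs_weight_le_of_blockEnvelope hN hM hc.le y (fun u' => hK κ u') u) (by positivity)
  have hgr : ∀ κ u, |grad (bmGaugeAt (toSite r) (colH K N μ y) N) κ u|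
      ≤ (2 * (((d : ℝ) + 1) * N) * M * (1 + Real.exp c)) * Real.exp c * Real.exp (-δ₀ * l1 (u - (N : ℤ) • y)) := fun κ =>
    hrelax (fun u => abs_grad_weight_le hN hr K μ y hM hc.le hK κ u) (by positivity)
  have hchi : ∀ u, |bmGaugeAt (toSite r) (colH K N μ y) N u| ≤ (2 * (((d : ℝ) + 1) * N) * M) * Real.exp c * Real.exp (-δ₀ * l1 (u - (N : ℤ) • y)) :=
    hrelax (fun u => abs_bmGaugeAt_weight_le hN hr K μ y hM hc.le hK u) (by positivity)
  -- pointwise: the column split under `wsum`, then §2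
  have hsbp := sum_wsum_grad_eq_wsum_divV hchi hS₀ hδ₀pos (by positivity)
  funext x z a b
  have hterm : ∀ κ : Fin (d + 1), wsum (colH (coDressKBmAt (toSite r) N K) N μ y κ) (S κ) x z a b
      = wsum (colH K N μ y κ) (S κ) x z a b - wsum (grad (bmGaugeAt (toSite r) (colH K N μ y) N) κ) (S κ) x z a b := fun κ => by
    have hsK := summable_wsumTerm (hcol κ) (fun u => hS₀ κ u) hδ₀pos (by positivity) x z a b
    have hsG := summable_wsumTerm (hgr κ) (fun u => hS₀ κ u) hδ₀pos (by positivity) x z a b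
    show (∑' u : Site (d + 1), colH (coDressKBmAt (toSite r) N K) N μ y κ u * S κ u x z a b) = _
    have e1 : (fun u : Site (d + 1) => colH (coDressKBmAt (toSite r) N K) N μ y κ u * S κ u x z a b)
        = fun u => colH K N μ y κ u * S κ u x z a b - grad (bmGaugeAt (toSite r) (colH K N μ y) N) κ u * S κ u x z a b := by
      funext u
      rw [colH_coDressKBmAt_eq_sub_grad hN hr K μ y κ u]
      show _ = _ - (bmGaugeAt (toSite r) (colH K N μ y) N (u + unitVec κ) - bmGaugeAt (toSite r) (colH K N μ y) N u) * S κ u x z a b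
      ring
    rw [e1, hsK.tsum_sub hsG]
    rfl
  show (∑ κ : Fin (d + 1), wsum (colH (coDressKBmAt (toSite r) N K) N μ y κ) (S κ) x z a b)
      = (∑ κ : Fin (d + 1), wsum (colH K N μ y κ) (S κ) x z a b) - wsum (bmGaugeAt (toSite r) (colH K N μ y) N) (divV S) x z a b
  rw [Finset.sum_congr rfl fun κ _ => hterm κ, Finset.sum_sub_distrib, ← hsbp]

end Summit.QuantumFields.BalabanUV.Beta.D1BFx.DressedVertexSplit

end
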